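import Literature.Computability.AlgebraicComplexity.SLOrbitMapQuotient
import Literature.Computability.AlgebraicComplexity.OrbitClosureProofs
import Literature.Geometry.Kaehler.ComplexTorusSpecialLinearGroupConnected
import HarnessLib

/-!
# The orbit map of a closed `SL`-orbit of forms is a quotient — I: the three function algebras
# `ℂ[SL·w] ⊆ ℂ[SL]^{G_w} ⊆ ℂ[SL]` (set-up of the proof of `Grosshans1997_thm_1_11_slOrbit_forms`)

Topic `Literature/Computability/AlgebraicComplexity`. First file of the discharge programme for the
cite-fact `Grosshans1997_thm_1_11_slOrbit_forms` (`SLOrbitMapQuotient.lean`; Borel, *Linear Algebraic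
Groups*, Prop. 6.7 = Grosshans 1997, Thm. 1.11, characteristic `0`, special case `G = SL_σ(ℂ)` acting
on forms): the CURRENCY of the proof — plumbing definitions (no mathematical content beyond Borel's
objects) and their elementary API. Everything here is definitional bookkeeping of

* `ℂ[SL]` = `coordFns σ`, the algebra of polynomial functions on `SL_σ(ℂ)` (restrictions of
  polynomials in the `σ × σ` matrix entries; the image of `slEval`);
* `ℂ[SL]^{H}` = `rightInvariants w`, the functions of `ℂ[SL]` invariant under RIGHT translation by the
  stabiliser `H = SL_σ(ℂ) ∩ G_w` of the form `w` (Borel's `k[G]^{G_x}`, the coordinate ring of the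
  homogeneous space `G/G_x`, [cite: Grosshans1997, Thm. 1.11 and §1 («k[G/H] = k[G]^H»)]);
* `ℂ[SL·w]` = `orbitPullbacks w m`, the pull-backs `g ↦ F(g·w)` of polynomials `F` on `Sym^m` along the
  orbit map (the image of `orbitPullback w m`; for `w` polystable = the coordinate ring of the closed
  orbit `SL·w ⊆ Sym^m`);

together with: the inclusions `orbitPullbacks w m ≤ rightInvariants w ≤ coordFns σ`
(`SLOrbitMapQuotient.aeval_formCoeff_linSubst_mul_of_stabilizer`, `eval_coeff_genericLinSubst`); the
evaluation characters `evalAt g` and their kernels (the points `gH` of `G/H`, resp. `g·w` of the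
orbit): `ker_evalAt_rightInvariants_eq_of` (`gH = g'H ⇒` same point), `linSubst_eq_of_ker_evalAt_orbitPullbacks_eq`
(`ℂ[SL·w]` separates the orbit); LEFT translation `leftTranslate γ` (an algebra automorphism of
`SL → ℂ`) preserves all three algebras (`coordSubst` equivariance of the tree's `OrbitCoordinateRing`);
and `ℂ[SL]` is an integral domain (`SL_σ(ℂ)` is irreducible: the tree's
`ComplexTorus.mem_vanishingIdealC_top_or_of_mul_mem`), hence so are the two subalgebras.

The theorem `rightInvariants w ≤ orbitPullbacks w m` (for `w` polystable) — i.e. the fact — is proved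
in the companion files (Reynolds operator for `H`; maximal ideals; Zariski's Main Theorem;
birationality; homogeneity), ending in `SLOrbitQuotientHolds.lean`
(`Grosshans1997_thm_1_11_slOrbit_forms_holds`, whence `MS08_thm_1_8a_holds` by
`MS08BorelWeilSufficiency.MS08_thm_1_8a_of_orbitQuotient`). No instance, no notation, no named fact
(D-0026: net debt 0). Honest framing: textbook algebraic-group theory; nothing here bears on VP
versus VNP.

## References

* [Grosshans1997] F. D. Grosshans, *Algebraic Homogeneous Spaces and Invariant Theory*, LNM 1673
  (1997), §1 (`k[G/H] = k[G]^H`), Thm. 1.11 (= Borel, LAG, Prop. 6.7).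
* [SpringerLAG1998] T. A. Springer, *Linear Algebraic Groups*, 2nd ed. (1998), 2.1.4, Thm. 5.5.5.

## Provenance

Cell `val-lit`, seat `val-lit-t02` generation 7 (programme #7, architect's currency file).
-/

noncomputable section

open MvPolynomial

namespace Literature.Computability.AlgebraicComplexity

namespace SLOrbitQuotient

variable {σ : Type} [Fintype σ] [DecidableEq σ]

/-! ### § 1 Polynomial functions on `SL_σ(ℂ)` -/

/-- The coordinate function `g ↦ g_{ij}` on `SL_σ(ℂ)`. [cite: SpringerLAG1998, 2.1.4 (`k[SL_n] = k[T_{ij}]/(det − 1)`)] -/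
def entryFn (ij : σ × σ) : Matrix.SpecialLinearGroup σ ℂ → ℂ :=
  fun g => (g : Matrix σ σ ℂ) ij.1 ij.2

/-- Evaluation of a polynomial in the matrix entries as a function on `SL_σ(ℂ)` (the restriction map
`ℂ[x_{ij}] → ℂ[SL]`). [cite: SpringerLAG1998, 2.1.4] -/
def slEval : MvPolynomial (σ × σ) ℂ →ₐ[ℂ] (Matrix.SpecialLinearGroup σ ℂ → ℂ) :=
  aeval entryFn

/-- `slEval f g = f(g)`. [cite: SpringerLAG1998, 2.1.4] -/
theorem slEval_apply (f : MvPolynomial (σ × σ) ℂ) (g : Matrix.SpecialLinearGroup σ ℂ) :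
    slEval f g = MvPolynomial.eval (fun ij : σ × σ => (g : Matrix σ σ ℂ) ij.1 ij.2) f := by
  change (Pi.evalAlgHom ℂ (fun _ : Matrix.SpecialLinearGroup σ ℂ => ℂ) g) (aeval entryFn f) = _
  rw [← AlgHom.comp_apply, MvPolynomial.comp_aeval]
  exact congrFun (aeval_eq_eval (S₁ := ℂ) (fun ij : σ × σ => (g : Matrix σ σ ℂ) ij.1 ij.2)) f

variable (σ) in
/-- **`ℂ[SL]`**: the algebra of polynomial functions on `SL_σ(ℂ)` (restrictions of polynomials in the
matrix entries). [cite: SpringerLAG1998, 2.1.4] -/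
def coordFns : Subalgebra ℂ (Matrix.SpecialLinearGroup σ ℂ → ℂ) :=
  (slEval (σ := σ)).range

/-- Membership in `ℂ[SL]`. [cite: SpringerLAG1998, 2.1.4] -/
theorem mem_coordFns_iff {φ : Matrix.SpecialLinearGroup σ ℂ → ℂ} :
    φ ∈ coordFns σ ↔ ∃ f : MvPolynomial (σ × σ) ℂ, slEval f = φ :=
  AlgHom.mem_range _

/-- `slEval f ∈ ℂ[SL]`. [cite: SpringerLAG1998, 2.1.4] -/
theorem slEval_mem_coordFns (f : MvPolynomial (σ × σ) ℂ) : slEval f ∈ coordFns σ :=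
  ⟨f, rfl⟩

/-- `slEval f = 0` iff `f` lies in the vanishing ideal of `SL_σ(ℂ)` (the tree's
`ComplexTorus.vanishingIdealC ⊤`). [cite: SpringerLAG1998, 2.1.4] -/
theorem slEval_eq_zero_iff (f : MvPolynomial (σ × σ) ℂ) :
    slEval f = 0 ↔ f ∈ Literature.Geometry.Kaehler.ComplexTorus.vanishingIdealC
      (⊤ : Subgroup (Matrix.SpecialLinearGroup σ ℂ)) := by
  rw [Literature.Geometry.Kaehler.ComplexTorus.mem_vanishingIdealC_iff, funext_iff]
  simp only [Subgroup.mem_top, forall_true_left, Pi.zero_apply, slEval_apply]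
  refine forall_congr' fun g => ?_
  rw [Literature.Geometry.Kaehler.ComplexTorus.evalMatC]
  exact Iff.of_eq (congrArg (· = (0 : ℂ))
    (congrFun (aeval_eq_eval (S₁ := ℂ) (fun ij : σ × σ => (g.1 : Matrix σ σ ℂ) ij.1 ij.2)) f).symm)

/-- **`ℂ[SL]` is an integral domain** (`SL_σ(ℂ)` is irreducible; the tree's
`ComplexTorus.mem_vanishingIdealC_top_or_of_mul_mem`), in the form: a product of two polynomial
functions on `SL_σ(ℂ)` vanishes only if a factor does. [cite: SpringerLAG1998, 2.1.4 and 2.2.1] -/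
theorem eq_zero_or_eq_zero_of_mul_eq_zero {φ ψ : Matrix.SpecialLinearGroup σ ℂ → ℂ}
    (hφ : φ ∈ coordFns σ) (hψ : ψ ∈ coordFns σ) (h : φ * ψ = 0) : φ = 0 ∨ ψ = 0 := by
  obtain ⟨f, rfl⟩ := mem_coordFns_iff.mp hφ
  obtain ⟨f', rfl⟩ := mem_coordFns_iff.mp hψ
  rw [← map_mul, slEval_eq_zero_iff] at h
  rcases Literature.Geometry.Kaehler.ComplexTorus.mem_vanishingIdealC_top_or_of_mul_mem h with h1 | h1
  · exact Or.inl ((slEval_eq_zero_iff f).mpr h1)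
  · exact Or.inr ((slEval_eq_zero_iff f').mpr h1)

/-- Every subalgebra of `ℂ[SL]` is an integral domain. [cite: SpringerLAG1998, 2.1.4 and 2.2.1] -/
theorem isDomain_of_le {S : Subalgebra ℂ (Matrix.SpecialLinearGroup σ ℂ → ℂ)} (hS : S ≤ coordFns σ) :
    IsDomain S := by
  have : Nontrivial S := inferInstance
  refine @NoZeroDivisors.to_isDomain S _ this ⟨fun {a b} hab => ?_⟩
  have hab' : (a : Matrix.SpecialLinearGroup σ ℂ → ℂ) * b = 0 := by
    rw [← Subalgebra.coe_mul, hab, Subalgebra.coe_zero]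
  rcases eq_zero_or_eq_zero_of_mul_eq_zero (hS a.2) (hS b.2) hab' with h | h
  · exact Or.inl (Subtype.ext h)
  · exact Or.inr (Subtype.ext h)

/-- `ℂ[SL]` is an integral domain. [cite: SpringerLAG1998, 2.1.4 and 2.2.1] -/
theorem isDomain_coordFns : IsDomain (coordFns σ) :=
  isDomain_of_le le_rfl

/-! ### § 2 Right invariants `ℂ[SL]^{H}`, `H = SL ∩ G_w` -/

/-- **`ℂ[SL]^{G_w}`**: the polynomial functions on `SL_σ(ℂ)` invariant under right translation by
the stabiliser `SL_σ(ℂ) ∩ G_w` of the form `w` (the coordinate ring `k[G]^{G_x}` of the homogeneous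
space `G/G_x`). [cite: Grosshans1997, §1 and Thm. 1.11] -/
def rightInvariants (w : MvPolynomial σ ℂ) : Subalgebra ℂ (Matrix.SpecialLinearGroup σ ℂ → ℂ) where
  carrier := {φ | φ ∈ coordFns σ ∧ ∀ g h : Matrix.SpecialLinearGroup σ ℂ,
    linSubst σ ℂ (h : Matrix σ σ ℂ) w = w → φ (g * h) = φ g}
  mul_mem' := fun {a b} ha hb => ⟨mul_mem ha.1 hb.1, fun g h hh => by
    simp only [Pi.mul_apply, ha.2 g h hh, hb.2 g h hh]⟩
  add_mem' := fun {a b} ha hb => ⟨add_mem ha.1 hb.1, fun g h hh => by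
    simp only [Pi.add_apply, ha.2 g h hh, hb.2 g h hh]⟩
  algebraMap_mem' := fun c => ⟨Subalgebra.algebraMap_mem _ c, fun g h _ => rfl⟩

/-- Membership in `ℂ[SL]^{G_w}`. [cite: Grosshans1997, §1] -/
theorem mem_rightInvariants_iff {w : MvPolynomial σ ℂ} {φ : Matrix.SpecialLinearGroup σ ℂ → ℂ} :
    φ ∈ rightInvariants w ↔ φ ∈ coordFns σ ∧ ∀ g h : Matrix.SpecialLinearGroup σ ℂ,
      linSubst σ ℂ (h : Matrix σ σ ℂ) w = w → φ (g * h) = φ g :=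
  Iff.rfl

/-- `ℂ[SL]^{G_w} ≤ ℂ[SL]`. [cite: Grosshans1997, §1] -/
theorem rightInvariants_le_coordFns (w : MvPolynomial σ ℂ) : rightInvariants w ≤ coordFns σ :=
  fun _ hφ => hφ.1

/-! ### § 3 Pull-backs along the orbit map `ℂ[SL·w]` -/

/-- The pull-back `g ↦ coeff_d (g·w)` of the coordinate `d` of `Sym^m` along the orbit map
`g ↦ g·w`. [cite: Grosshans1997, Thm. 1.11 (the orbit map `π : G → G·x`)] -/
def orbitFn (w : MvPolynomial σ ℂ) (m : ℕ) (d : DegIdx σ m) : Matrix.SpecialLinearGroup σ ℂ → ℂ :=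
  fun g => coeff d.1 (linSubst σ ℂ (g : Matrix σ σ ℂ) w)

/-- The pull-back homomorphism `π^* : ℂ[Sym^m] → (SL → ℂ)`, `F ↦ (g ↦ F(g·w))`.
[cite: Grosshans1997, Thm. 1.11 (the orbit map `π`)] -/
def orbitPullback (w : MvPolynomial σ ℂ) (m : ℕ) :
    MvPolynomial (DegIdx σ m) ℂ →ₐ[ℂ] (Matrix.SpecialLinearGroup σ ℂ → ℂ) :=
  aeval (orbitFn w m)

/-- `π^* F (g) = F(g·w)` in the tree's coordinates `formCoeff m`. [cite: Grosshans1997, Thm. 1.11] -/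
theorem orbitPullback_apply (w : MvPolynomial σ ℂ) (m : ℕ)
    (F : MvPolynomial (DegIdx σ m) ℂ) (g : Matrix.SpecialLinearGroup σ ℂ) :
    orbitPullback w m F g = aeval (formCoeff m (linSubst σ ℂ (g : Matrix σ σ ℂ) w)) F := by
  change (Pi.evalAlgHom ℂ (fun _ : Matrix.SpecialLinearGroup σ ℂ => ℂ) g) (aeval (orbitFn w m) F) = _
  rw [← AlgHom.comp_apply, MvPolynomial.comp_aeval]
  rfl

/-- **`ℂ[SL·w]`** (as functions on `SL`): the algebra of pull-backs `g ↦ F(g·w)` of polynomials on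
`Sym^m` along the orbit map. [cite: Grosshans1997, Thm. 1.11] -/
def orbitPullbacks (w : MvPolynomial σ ℂ) (m : ℕ) : Subalgebra ℂ (Matrix.SpecialLinearGroup σ ℂ → ℂ) :=
  (orbitPullback w m).range

/-- Membership in `ℂ[SL·w]`. [cite: Grosshans1997, Thm. 1.11] -/
theorem mem_orbitPullbacks_iff {w : MvPolynomial σ ℂ} {m : ℕ} {φ : Matrix.SpecialLinearGroup σ ℂ → ℂ} :
    φ ∈ orbitPullbacks w m ↔ ∃ F : MvPolynomial (DegIdx σ m) ℂ, orbitPullback w m F = φ :=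
  AlgHom.mem_range _

/-- The coordinate pull-backs are polynomial functions on `SL` (`eval_coeff_genericLinSubst`).
[cite: Grosshans1997, Thm. 1.11] -/
theorem orbitFn_eq_slEval (w : MvPolynomial σ ℂ) (m : ℕ) (d : DegIdx σ m) :
    orbitFn w m d = slEval (coeff d.1 (linSubst σ (MvPolynomial (σ × σ) ℂ)
      (Matrix.mvPolynomialX σ σ ℂ) (map (C : ℂ →+* MvPolynomial (σ × σ) ℂ) w))) := by
  funext g
  rw [slEval_apply, eval_coeff_genericLinSubst]
  rfl

/-- The coordinate pull-backs lie in `ℂ[SL]`. [cite: Grosshans1997, Thm. 1.11] -/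
theorem orbitFn_mem_coordFns (w : MvPolynomial σ ℂ) (m : ℕ) (d : DegIdx σ m) :
    orbitFn w m d ∈ coordFns σ := by
  rw [orbitFn_eq_slEval]
  exact slEval_mem_coordFns _

/-- Right translation by the stabiliser fixes the coordinate pull-backs (the orbit map is constant
on the cosets `gH`; `linSubst` is a left action). [cite: Grosshans1997, Thm. 1.11] -/
theorem orbitFn_mul_of_linSubst_eq (w : MvPolynomial σ ℂ) (m : ℕ) (d : DegIdx σ m)
    (g h : Matrix.SpecialLinearGroup σ ℂ) (hh : linSubst σ ℂ (h : Matrix σ σ ℂ) w = w) :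
    orbitFn w m d (g * h) = orbitFn w m d g := by
  simp only [orbitFn, Matrix.SpecialLinearGroup.coe_mul, linSubst_mul, AlgHom.comp_apply, hh]

/-- The coordinate pull-backs lie in `ℂ[SL]^{G_w}`. [cite: Grosshans1997, Thm. 1.11] -/
theorem orbitFn_mem_rightInvariants (w : MvPolynomial σ ℂ) (m : ℕ) (d : DegIdx σ m) :
    orbitFn w m d ∈ rightInvariants w :=
  ⟨orbitFn_mem_coordFns w m d, fun g h hh => orbitFn_mul_of_linSubst_eq w m d g h hh⟩

/-- `ℂ[SL·w]` is generated by the coordinate pull-backs. [cite: Grosshans1997, Thm. 1.11] -/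
theorem orbitPullbacks_eq_adjoin (w : MvPolynomial σ ℂ) (m : ℕ) :
    orbitPullbacks w m = Algebra.adjoin ℂ (Set.range (orbitFn w m)) :=
  aeval_range _

/-- **`ℂ[SL·w] ≤ ℂ[SL]^{G_w}`** (pull-backs along the orbit map are right-`H`-invariant).
[cite: Grosshans1997, Thm. 1.11] -/
theorem orbitPullbacks_le_rightInvariants (w : MvPolynomial σ ℂ) (m : ℕ) :
    orbitPullbacks w m ≤ rightInvariants w := by
  rw [orbitPullbacks_eq_adjoin]
  refine Algebra.adjoin_le ?_
  rintro _ ⟨d, rfl⟩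
  exact orbitFn_mem_rightInvariants w m d

/-- `ℂ[SL·w] ≤ ℂ[SL]`. [cite: Grosshans1997, Thm. 1.11] -/
theorem orbitPullbacks_le_coordFns (w : MvPolynomial σ ℂ) (m : ℕ) : orbitPullbacks w m ≤ coordFns σ :=
  (orbitPullbacks_le_rightInvariants w m).trans (rightInvariants_le_coordFns w)

/-- `ℂ[SL]^{G_w}` is an integral domain. [cite: SpringerLAG1998, 2.2.1 with 2.1.4] -/
theorem isDomain_rightInvariants (w : MvPolynomial σ ℂ) : IsDomain (rightInvariants w) :=
  isDomain_of_le (rightInvariants_le_coordFns w)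

/-- `ℂ[SL·w]` is an integral domain. [cite: SpringerLAG1998, 2.2.1 with 2.1.4] -/
theorem isDomain_orbitPullbacks (w : MvPolynomial σ ℂ) (m : ℕ) : IsDomain (orbitPullbacks w m) :=
  isDomain_of_le (orbitPullbacks_le_coordFns w m)

/-! ### § 4 Points: the evaluation characters and their kernels -/

/-- Evaluation at `g ∈ SL_σ(ℂ)`, an algebra homomorphism `(SL → ℂ) → ℂ`. [cite: SpringerLAG1998, 1.3.1 (points as algebra homomorphisms)] -/
def evalAt (g : Matrix.SpecialLinearGroup σ ℂ) : (Matrix.SpecialLinearGroup σ ℂ → ℂ) →ₐ[ℂ] ℂ :=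
  Pi.evalAlgHom ℂ (fun _ : Matrix.SpecialLinearGroup σ ℂ => ℂ) g

/-- `evalAt g φ = φ g`. [cite: SpringerLAG1998, 1.3.1] -/
@[simp]
theorem evalAt_apply (g : Matrix.SpecialLinearGroup σ ℂ) (φ : Matrix.SpecialLinearGroup σ ℂ → ℂ) :
    evalAt g φ = φ g :=
  rfl

/-- The character of a subalgebra `S ≤ (SL → ℂ)` at the point `g`. [cite: SpringerLAG1998, 1.3.1] -/
def charAt (S : Subalgebra ℂ (Matrix.SpecialLinearGroup σ ℂ → ℂ)) (g : Matrix.SpecialLinearGroup σ ℂ) :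
    S →ₐ[ℂ] ℂ :=
  (evalAt g).comp S.val

/-- `charAt S g φ = φ g`. [cite: SpringerLAG1998, 1.3.1] -/
@[simp]
theorem charAt_apply (S : Subalgebra ℂ (Matrix.SpecialLinearGroup σ ℂ → ℂ))
    (g : Matrix.SpecialLinearGroup σ ℂ) (φ : S) : charAt S g φ = (φ : Matrix.SpecialLinearGroup σ ℂ → ℂ) g :=
  rfl

/-- The characters are surjective. [cite: SpringerLAG1998, 1.3.1] -/
theorem charAt_surjective (S : Subalgebra ℂ (Matrix.SpecialLinearGroup σ ℂ → ℂ))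
    (g : Matrix.SpecialLinearGroup σ ℂ) : Function.Surjective (charAt S g) :=
  fun c => ⟨algebraMap ℂ S c, by simp⟩

/-- The kernel of a character is a maximal ideal. [cite: SpringerLAG1998, 1.3.1] -/
theorem ker_charAt_isMaximal (S : Subalgebra ℂ (Matrix.SpecialLinearGroup σ ℂ → ℂ))
    (g : Matrix.SpecialLinearGroup σ ℂ) : (RingHom.ker (charAt S g)).IsMaximal :=
  RingHom.ker_isMaximal_of_surjective _ (charAt_surjective S g)

/-- Kernels of characters are compatible with inclusions of subalgebras. [cite: SpringerLAG1998, 1.3.1] -/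
theorem comap_inclusion_ker_charAt {S T : Subalgebra ℂ (Matrix.SpecialLinearGroup σ ℂ → ℂ)}
    (hST : S ≤ T) (g : Matrix.SpecialLinearGroup σ ℂ) :
    (RingHom.ker (charAt T g)).comap (Subalgebra.inclusion hST) = RingHom.ker (charAt S g) := by
  ext φ
  simp only [Ideal.mem_comap, RingHom.mem_ker, charAt_apply, Subalgebra.coe_inclusion]

/-- **Cosets give the same point of `G/H`**: if `g·w = g'·w` then the characters of `ℂ[SL]^{G_w}` at
`g` and `g'` coincide. [cite: Grosshans1997, §1 (points of `G/H`)] -/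
theorem charAt_rightInvariants_eq_of_linSubst_eq {w : MvPolynomial σ ℂ}
    {g g' : Matrix.SpecialLinearGroup σ ℂ}
    (h : linSubst σ ℂ (g : Matrix σ σ ℂ) w = linSubst σ ℂ (g' : Matrix σ σ ℂ) w) :
    charAt (rightInvariants w) g = charAt (rightInvariants w) g' := by
  ext φ
  have hstab : linSubst σ ℂ ((g⁻¹ * g' : Matrix.SpecialLinearGroup σ ℂ) : Matrix σ σ ℂ) w = w := by
    have h1 : linSubst σ ℂ ((g⁻¹ : Matrix.SpecialLinearGroup σ ℂ) : Matrix σ σ ℂ)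
        (linSubst σ ℂ (g : Matrix σ σ ℂ) w) = w := by
      rw [← AlgHom.comp_apply, ← linSubst_mul, ← Matrix.SpecialLinearGroup.coe_mul, inv_mul_cancel,
        Matrix.SpecialLinearGroup.coe_one, linSubst_one, AlgHom.id_apply]
    rw [Matrix.SpecialLinearGroup.coe_mul, linSubst_mul, AlgHom.comp_apply, ← h, h1]
  have := φ.2.2 g (g⁻¹ * g') hstab
  rw [mul_inv_cancel_left] at this
  simp only [charAt_apply, this]

/-- Hence the kernels coincide. [cite: Grosshans1997, §1] -/
theorem ker_charAt_rightInvariants_eq_of_linSubst_eq {w : MvPolynomial σ ℂ}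
    {g g' : Matrix.SpecialLinearGroup σ ℂ}
    (h : linSubst σ ℂ (g : Matrix σ σ ℂ) w = linSubst σ ℂ (g' : Matrix σ σ ℂ) w) :
    RingHom.ker (charAt (rightInvariants w) g) = RingHom.ker (charAt (rightInvariants w) g') := by
  rw [charAt_rightInvariants_eq_of_linSubst_eq h]

/-- **`ℂ[SL·w]` separates the orbit**: if the characters of `ℂ[SL·w]` at `g`, `g'` have the same
kernel then `g·w = g'·w` (for `w` a form of degree `m`: the degree-`m` coefficients are pull-backs).
[cite: Grosshans1997, Thm. 1.11] -/
theorem linSubst_eq_of_ker_charAt_orbitPullbacks_eq {w : MvPolynomial σ ℂ} {m : ℕ}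
    (hw : w.IsHomogeneous m) {g g' : Matrix.SpecialLinearGroup σ ℂ}
    (h : RingHom.ker (charAt (orbitPullbacks w m) g) = RingHom.ker (charAt (orbitPullbacks w m) g')) :
    linSubst σ ℂ (g : Matrix σ σ ℂ) w = linSubst σ ℂ (g' : Matrix σ σ ℂ) w := by
  have key : ∀ d : DegIdx σ m, orbitFn w m d g = orbitFn w m d g' := by
    intro d
    have hmem : orbitFn w m d ∈ orbitPullbacks w m := by
      rw [orbitPullbacks_eq_adjoin]; exact Algebra.subset_adjoin ⟨d, rfl⟩
    set ψ : orbitPullbacks w m := ⟨orbitFn w m d, hmem⟩ - algebraMap ℂ _ (orbitFn w m d g) with hψ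
    have h1 : ψ ∈ RingHom.ker (charAt (orbitPullbacks w m) g) := by
      rw [RingHom.mem_ker, hψ, map_sub, charAt_apply, AlgHom.commutes]; exact sub_self _
    rw [h, RingHom.mem_ker, hψ, map_sub, charAt_apply, AlgHom.commutes] at h1
    exact (sub_eq_zero.mp h1).symm
  have hfc : formCoeff m (linSubst σ ℂ (g : Matrix σ σ ℂ) w) =
      formCoeff m (linSubst σ ℂ (g' : Matrix σ σ ℂ) w) := funext key
  exact formCoeff_injOn_homogeneousSubmodule m
    ((mem_homogeneousSubmodule m _).mpr (linSubst_isHomogeneous _ hw))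
    ((mem_homogeneousSubmodule m _).mpr (linSubst_isHomogeneous _ hw)) hfc

/-! ### § 5 Left translation -/

/-- Left translation `(L_γ φ)(g) = φ(γ⁻¹ g)`, an algebra endomorphism of `SL → ℂ`.
[cite: SpringerLAG1998, 2.3.5 (left translation `λ(x)`)] -/
def leftTranslate (γ : Matrix.SpecialLinearGroup σ ℂ) :
    (Matrix.SpecialLinearGroup σ ℂ → ℂ) →ₐ[ℂ] (Matrix.SpecialLinearGroup σ ℂ → ℂ) :=
  AlgHom.pi fun g => evalAt (γ⁻¹ * g)

/-- `(L_γ φ)(g) = φ(γ⁻¹ g)`. [cite: SpringerLAG1998, 2.3.5] -/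
@[simp]
theorem leftTranslate_apply (γ : Matrix.SpecialLinearGroup σ ℂ) (φ : Matrix.SpecialLinearGroup σ ℂ → ℂ)
    (g : Matrix.SpecialLinearGroup σ ℂ) : leftTranslate γ φ g = φ (γ⁻¹ * g) :=
  rfl

/-- `L_γ ∘ L_{γ⁻¹} = id`. [cite: SpringerLAG1998, 2.3.5] -/
theorem leftTranslate_leftTranslate_inv (γ : Matrix.SpecialLinearGroup σ ℂ)
    (φ : Matrix.SpecialLinearGroup σ ℂ → ℂ) : leftTranslate γ (leftTranslate γ⁻¹ φ) = φ := by
  funext g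
  simp only [leftTranslate_apply, inv_inv, mul_inv_cancel_left]

/-- Left translation of a polynomial function is the polynomial function of the substituted
polynomial `x ↦ γ⁻¹ x`. [cite: SpringerLAG1998, 2.3.5] -/
theorem leftTranslate_slEval (γ : Matrix.SpecialLinearGroup σ ℂ) (f : MvPolynomial (σ × σ) ℂ) :
    leftTranslate γ (slEval f) = slEval (aeval (fun ij : σ × σ =>
      ∑ k : σ, C (((γ⁻¹ : Matrix.SpecialLinearGroup σ ℂ) : Matrix σ σ ℂ) ij.1 k) * X (k, ij.2)) f) := by
  set ψ : σ × σ → MvPolynomial (σ × σ) ℂ := fun ij =>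
    ∑ k : σ, C (((γ⁻¹ : Matrix.SpecialLinearGroup σ ℂ) : Matrix σ σ ℂ) ij.1 k) * X (k, ij.2) with hψ
  suffices H : (leftTranslate γ).comp slEval = slEval.comp (aeval ψ) from congr($H f)
  apply MvPolynomial.algHom_ext
  intro ij
  funext g
  rw [AlgHom.comp_apply, AlgHom.comp_apply, aeval_X, leftTranslate_apply, slEval_apply, slEval_apply,
    eval_X, Matrix.SpecialLinearGroup.coe_mul, Matrix.mul_apply, hψ]
  simp only [map_sum, map_mul, eval_C, eval_X]

/-- Left translation preserves `ℂ[SL]`. [cite: SpringerLAG1998, 2.3.5] -/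
theorem leftTranslate_mem_coordFns (γ : Matrix.SpecialLinearGroup σ ℂ)
    {φ : Matrix.SpecialLinearGroup σ ℂ → ℂ} (hφ : φ ∈ coordFns σ) : leftTranslate γ φ ∈ coordFns σ := by
  obtain ⟨f, rfl⟩ := mem_coordFns_iff.mp hφ
  rw [leftTranslate_slEval]
  exact slEval_mem_coordFns _

/-- Left translation preserves `ℂ[SL]^{G_w}` (left and right translations commute).
[cite: Grosshans1997, §1] -/
theorem leftTranslate_mem_rightInvariants (γ : Matrix.SpecialLinearGroup σ ℂ) {w : MvPolynomial σ ℂ}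
    {φ : Matrix.SpecialLinearGroup σ ℂ → ℂ} (hφ : φ ∈ rightInvariants w) :
    leftTranslate γ φ ∈ rightInvariants w :=
  ⟨leftTranslate_mem_coordFns γ hφ.1, fun g h hh => by
    rw [leftTranslate_apply, leftTranslate_apply, ← mul_assoc, hφ.2 _ h hh]⟩

/-- Left translation of a pull-back is the pull-back of the translated polynomial on `Sym^m`
(equivariance of the orbit map; the tree's `aeval_formCoeff_coordSubst`).
[cite: Grosshans1997, Thm. 1.11 (the orbit map is `G`-equivariant)] -/
theorem leftTranslate_orbitPullback (γ : Matrix.SpecialLinearGroup σ ℂ) (w : MvPolynomial σ ℂ) (m : ℕ)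
    (F : MvPolynomial (DegIdx σ m) ℂ) :
    leftTranslate γ (orbitPullback w m F) =
      orbitPullback w m (coordSubst m (Matrix.SpecialLinearGroup.toGL γ) F) := by
  funext g
  rw [leftTranslate_apply, orbitPullback_apply, orbitPullback_apply, aeval_formCoeff_coordSubst,
    linSubstRep_apply, Matrix.SpecialLinearGroup.coe_mul, linSubst_mul, AlgHom.comp_apply, ← map_inv,
    Matrix.SpecialLinearGroup.coe_GL_coe_matrix]

/-- Left translation preserves `ℂ[SL·w]`. [cite: Grosshans1997, Thm. 1.11] -/
theorem leftTranslate_mem_orbitPullbacks (γ : Matrix.SpecialLinearGroup σ ℂ) {w : MvPolynomial σ ℂ} {m : ℕ}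
    {φ : Matrix.SpecialLinearGroup σ ℂ → ℂ} (hφ : φ ∈ orbitPullbacks w m) :
    leftTranslate γ φ ∈ orbitPullbacks w m := by
  obtain ⟨F, rfl⟩ := mem_orbitPullbacks_iff.mp hφ
  rw [leftTranslate_orbitPullback]
  exact ⟨_, rfl⟩

end SLOrbitQuotient

end Literature.Computability.AlgebraicComplexity

end
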